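import Literature.Geometry.Lorentzian.SpacetimeLocalConvergence
import Literature.Geometry.Lorentzian.Causality
import HarnessLib

/-!
# `ChartSegmentChronological`: a timelike, future-directed chart segment joins its endpoints chronologically
(crux `GapExhaustion`, stmt-FinalStateConjecture-10808, line photon-shell-pseudoconvexity;
stub (E-3) `stub_chartSegment_chronological` of §1f "ESCAPE")

§1f of the line joins a band point of a near-Kerr chart to the far zone by a chain of short
straight chart segments. This file is the manifold glue turning ONE such segment into the
chronological relation of the ambient spacetime `𝓢`: for a map `Φ : E4 → 𝓢` which is `C^∞` on
an open set `O ⊆ E4` containing the segment `z + s • v`, `s ∈ [0, s₀]`, `0 < s₀`, along which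
the pulled-back metric satisfies `g(dΦ v, dΦ v) < 0` (`Spacetime.metricInCoords`) and `dΦ v` is
future-directed, the curve `γ s := Φ (z + s • v)` is a future-directed timelike curve on
`[0, s₀]` (chain rule: `γ' s = dΦ_{z + s v} v`), whence `Φ (z + s₀ • v) ∈ I⁺(Φ z)`
(`LorentzianMetric.chronologicalFuture`; O'Neill 1983, Ch. 14, pp. 402–403).
-/

noncomputable section

-- D-0017: single-problem summit, `Summit.<S>.<S>.…` by design (cf. lakefile `weak.linter.dupNamespace`).
set_option linter.dupNamespace false

namespace Summit.FinalStateConjecture.FinalStateConjecture.Theorems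

open Set Literature.Geometry.Lorentzian
open scoped Manifold ContDiff Topology

/-- The straight chart line `s ↦ z + s • v` of `E4` has manifold derivative `h ↦ h • v` at every
parameter. [folklore] -/
private theorem chartSegment_hasMFDerivAt_line (z v : E4) (t : ℝ) :
    HasMFDerivAt 𝓘(ℝ, ℝ) 𝓘(ℝ, E4) (fun s : ℝ ↦ z + s • v) t
      (ContinuousLinearMap.smulRight (1 : ℝ →L[ℝ] ℝ) v) := by
  have h : HasDerivAt (fun s : ℝ ↦ z + s • v) v t := by
    simpa using ((hasDerivAt_id t).smul_const v).const_add z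
  exact hasMFDerivAt_iff_hasFDerivAt.2 h.hasFDerivAt

/-- **Chain rule along a chart segment.** If `Φ` is differentiable at `z + t • v`, then the curve
`s ↦ Φ (z + s • v)` is differentiable at `t` with velocity `dΦ_{z + t v} v`. [folklore] -/
private theorem chartSegment_velocity (𝓢 : Spacetime.{0} 4) (Φ : E4 → 𝓢.carrier) (z v : E4)
    (t : ℝ) (hΦ : MDifferentiableAt 𝓘(ℝ, E4) (𝓡 4) Φ (z + t • v)) :
    MDifferentiableAt 𝓘(ℝ, ℝ) (𝓡 4) (fun s : ℝ ↦ Φ (z + s • v)) t ∧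
      velocity (𝓡 4) (fun s : ℝ ↦ Φ (z + s • v)) t =
        mfderiv 𝓘(ℝ, E4) (𝓡 4) Φ (z + t • v) v := by
  have hline := chartSegment_hasMFDerivAt_line z v t
  have hcomp := hΦ.hasMFDerivAt.comp t hline
  refine ⟨hcomp.mdifferentiableAt, ?_⟩
  show mfderiv 𝓘(ℝ, ℝ) (𝓡 4) (Φ ∘ fun s : ℝ ↦ z + s • v) t (1 : ℝ) = _
  rw [hcomp.mfderiv]
  show mfderiv 𝓘(ℝ, E4) (𝓡 4) Φ (z + t • v)
      (ContinuousLinearMap.smulRight (1 : ℝ →L[ℝ] ℝ) v (1 : ℝ)) = _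
  simp

/-- **(E-3) manifold glue: a chart segment which is timelike and future-directed along its length
joins its endpoints chronologically.** For `Φ : E4 → 𝓢` smooth on an open `O` containing the
segment `{z + s • v | s ∈ [0, s₀]}`, `0 < s₀`, with `g(dΦ v, dΦ v) < 0` and `dΦ v` future-directed
along the segment, `Φ (z + s₀ • v) ∈ I⁺(Φ z)`: the curve `s ↦ Φ (z + s • v)` on `[0, s₀]` is a
future-directed timelike curve from `Φ z` (O'Neill 1983, Ch. 14, pp. 402–403, definition of
`I⁺`; chain rule). [cite: ONeill1983, Ch. 14  pp. 402–403] -/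
theorem stub_chartSegment_chronological :
    ∀ (𝓢 : Spacetime.{0} 4) (Φ : E4 → 𝓢.carrier) (O : Set E4) (z v : E4) (s₀ : ℝ),
      IsOpen O → ContMDiffOn 𝓘(ℝ, E4) (𝓡 4) ∞ Φ O → 0 < s₀ →
      (∀ s ∈ Icc (0 : ℝ) s₀, z + s • v ∈ O) →
      (∀ s ∈ Icc (0 : ℝ) s₀, 𝓢.metricInCoords Φ (z + s • v) v v < 0) →
      (∀ s ∈ Icc (0 : ℝ) s₀,
        𝓢.timeOrientation.IsFutureDirected (mfderiv 𝓘(ℝ, E4) (𝓡 4) Φ (z + s • v) v)) →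
      Φ (z + s₀ • v) ∈ 𝓢.metric.chronologicalFuture 𝓢.timeOrientation {Φ z} := by
  intro 𝓢 Φ O z v s₀ hO hΦ hs₀ hmem htl hfd
  rw [LorentzianMetric.mem_chronologicalFuture_iff]
  refine ⟨Φ z, rfl, fun s : ℝ ↦ Φ (z + s • v), 0, s₀, hs₀, ?_, by simp, rfl⟩
  intro t ht
  have hdiff : MDifferentiableAt 𝓘(ℝ, E4) (𝓡 4) Φ (z + t • v) :=
    ((hΦ _ (hmem t ht)).contMDiffAt (hO.mem_nhds (hmem t ht))).mdifferentiableAt (by simp)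
  obtain ⟨hmd, hvel⟩ := chartSegment_velocity 𝓢 Φ z v t hdiff
  refine ⟨hmd, ?_, ?_⟩
  · rw [hvel]
    have h := htl t ht
    rw [Spacetime.metricInCoords_apply] at h
    exact h
  · rw [hvel]
    exact hfd t ht

end Summit.FinalStateConjecture.FinalStateConjecture.Theorems

end
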